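import Summits.ResolutionOfSingularities.ResolutionOfSingularities.Theorems.EquisingularLiftEquisingularLiftNatBadShadow
import Summits.ResolutionOfSingularities.ResolutionOfSingularities.Theorems.EquisingularLiftEquisingularLiftNatFatTouchNotFinishing
import Literature.AlgebraicGeometry.Resolution.RegularCentreRsopPart
import Literature.AlgebraicGeometry.Resolution.StrictNormalCrossingsDescent
import HarnessLib

/-!
# [OURS · L1 W4.5(b) · EL♮] K-BADRED: through a VERY BAD point no `O`-flat centre with reduced special fibre inside the
# strict transform passes (any relative dimension); a bad point at which the strict transform is regular is very bad
# (crux `EquisingularLiftNat` = stmt-ResolutionOfSingularities-20038; K-∀n / K5-BMY necessity lane, kill test #50)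

HONEST FRAMING. OURS (cell res-hironaka, crux chain w45b, slot W4.5(b)); NOT a statement of any manuscript; replaces the role of
NOTHING in the manuscript; AI-written, AI review is weaker than expert review. Helper `--supports stmt-ResolutionOfSingularities-20038
--as helper`. Object K-BADRED of res-L1-w45b-strat-1's STRATEGY-CENSUS v11 (sha16 6d78683fc4832623) §4 (N6.2) / §5 R2‴; extends the BAD-LOCUS
kit (`…NatBadLocus` p530616, `…NatBadShadow` p534067: sections avoid bad points) from sections to EVERY relative dimension.

TRICHOTOMY (N6.2). At a special point `y` of a stage `X → Spec O` (uniformiser `ϖ`, germ `ϖ_y`) with strict transform `Ỹ = V(I) ∋ y`: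
GOOD ⇔ `ϖ_y ∉ 𝔪_y²`; BAD ⇔ `ϖ_y ∈ 𝔪_y²`; VERY BAD ⇔ `ϖ_y ∈ 𝔪_y · I_y`.

* `mem_of_mem_maximalIdeal_mul_of_le_sup` — THE RING CORE (any local ring `R`, ideals `I`, `J`, `ϖ ∈ 𝔪·I`): if `I ≤ J + (ϖ)` then
  `ϖ ∈ J`. (Five lines: `ϖ ∈ 𝔪I ⊆ 𝔪J + 𝔪ϖ`, so `(1 − μ)ϖ ∈ J` with `μ ∈ 𝔪`.) Reading: `J = I_{C′}` a centre through `y`, `I ≤ J + (ϖ)` ⟺ the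
  special fibre `C′_s = V(J + (ϖ))` is, near `y`, a (reduced) subscheme of `Ỹ`-with-`C′_s`… precisely «`C′_s` reduced at `y` and `(C′_s)_red ⊆ Ỹ`»
  gives `I ≤ √(J + (ϖ)) = J + (ϖ)` (`le_sup_of_le_radical_of_isRadical`); conclusion `ϖ ∈ J`: `C′ ⊆ X_s` near `y`, i.e. `C′` is NOT `O`-flat at `y`.
* `mem_maximalIdeal_mul_of_isRegularLocalRing_quotient` — BAD + `Ỹ` REGULAR AT `y` ⇒ VERY BAD: `R` regular local, `R/I` regular, `ϖ ∈ I ∩ 𝔪²` ⇒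
  `ϖ ∈ 𝔪·I` (`I = (e₁,…,e_c)` part of a regular system of parameters, `ϖ = Σ aᵢeᵢ ∈ 𝔪²` forces `aᵢ ∈ 𝔪`).
* `not_flat_of_veryBad` — SCHEME FORM in the currency of `…NatBadShadow`: `r : X → Spec O` (`O` a domain, `ϖ ≠ 0`), ideal sheaves `Y` (strict
  transform) and `C` (centre), `c` a point of `V(C)` over `y`; if `ϖ_y ∈ 𝔪_y · Y_y` (very bad) and `Y_y ≤ C_y + (ϖ_y)` (reduced special fibre inside
  `Ỹ`, stalk form), then `V(C) → X → Spec O` is NOT flat. Corollary `not_flat_of_veryBad_of_isRadical` with the two geometric clauses separated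
  (`Y_y ≤ √(C_y + (ϖ_y))` = set-theoretic E1 at `y`, cf. `stalkIdeal_vanishingIdeal_le_radical_sup_of_support_inter_subset` of p522183, and
  `C_y + (ϖ_y)` radical = `C′_s` reduced at `y`).

CONSEQUENCE (N6.2 corollary, informal): through a very bad point only RIBBON-type centres (non-reduced special fibre) pass; at the K5 specimen every
point of `Bad ∖ {v_P}` is very bad (N6.2 [py E]), the vertex `v_P` is bad but not very bad.

References: res-L1-w45b-strat-1 STRATEGY-CENSUS v11 N6.2; tree `…NatBadShadow` (`varpiGerm_ne_zero_of_flat`), `…NatBadLocus` (`varpiGerm_comp`),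
`…NatFatTouchNotFinishing` (`ker_stalkMap_subschemeι_eq_stalkIdeal`), `Literature…RegularCentreRsopPart` (`exists_isRsopPart_span_range_eq`),
`…StrictNormalCrossingsDescent` (`mem_maximalIdeal_of_sum_mul_mem_sq_of_rsop`) [Matsumura1987, Thm. 14.2].
-/

set_option linter.dupNamespace false -- mandated namespace `Summit.<Summit>.<Problem>` of this single-conjunct summit

universe u

open CategoryTheory AlgebraicGeometry TopologicalSpace Topology IsLocalRing
open Literature.AlgebraicGeometry.Resolution
open AlgebraicGeometry.Scheme.IdealSheafData

namespace Summit.ResolutionOfSingularities.ResolutionOfSingularities.Cruxes.EquisingularLiftNat.Sections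

namespace BadRed

/-! ## The ring core -/

/-- **K-BADRED, ring core.** In a local ring, if `ϖ ∈ 𝔪·I` and `I ≤ J + (ϖ)`, then `ϖ ∈ J`: write `ϖ = j + μϖ` with `j ∈ 𝔪J ⊆ J`,
`μ ∈ 𝔪`; then `(1 − μ)ϖ = j` and `1 − μ` is a unit. [folklore] -/
theorem mem_of_mem_maximalIdeal_mul_of_le_sup {R : Type u} [CommRing R] [IsLocalRing R] {I J : Ideal R} {ϖ : R}
    (hvb : ϖ ∈ maximalIdeal R * I) (hle : I ≤ J ⊔ Ideal.span {ϖ}) : ϖ ∈ J := by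
  have h1 : ϖ ∈ maximalIdeal R * J ⊔ maximalIdeal R * Ideal.span {ϖ} := by
    rw [← Ideal.mul_sup]
    exact Ideal.mul_mono_right hle hvb
  obtain ⟨j, hj, m, hm, hjm⟩ := Submodule.mem_sup.mp h1
  obtain ⟨μ, hμ, rfl⟩ := Ideal.mem_mul_span_singleton.mp hm
  have hu : IsUnit (1 - μ) := IsLocalRing.isUnit_one_sub_self_of_mem_nonunits μ hμ
  have hkey : (1 - μ) * ϖ = j := by
    rw [sub_mul, one_mul, sub_eq_iff_eq_add]
    exact hjm.symm
  obtain ⟨v, hv⟩ := hu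
  have : ϖ = ↑v⁻¹ * j := by
    rw [← hkey, ← hv, ← mul_assoc, Units.inv_mul, one_mul]
  rw [this]
  exact Ideal.mul_mem_left _ _ (Ideal.mul_le_left hj)

/-- If `C_y + (ϖ)` is radical (the special fibre of the centre is reduced at `y`) and `I ≤ √(C_y + (ϖ))` (set-theoretic E1 at `y`), then
`I ≤ C_y + (ϖ)`. [folklore] -/
theorem le_sup_of_le_radical_of_isRadical {R : Type u} [CommRing R] {I J : Ideal R} {ϖ : R}
    (hrad : (J ⊔ Ideal.span {ϖ}).IsRadical) (hE1 : I ≤ (J ⊔ Ideal.span {ϖ}).radical) : I ≤ J ⊔ Ideal.span {ϖ} :=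
  hE1.trans (le_of_eq hrad.radical)

/-- **K-BADRED with the geometric clauses separated**: `ϖ ∈ 𝔪·I`, `C_y + (ϖ)` radical, `I ≤ √(C_y + (ϖ))` ⇒ `ϖ ∈ C_y`. [folklore] -/
theorem mem_of_mem_maximalIdeal_mul_of_isRadical {R : Type u} [CommRing R] [IsLocalRing R] {I J : Ideal R} {ϖ : R}
    (hvb : ϖ ∈ maximalIdeal R * I) (hrad : (J ⊔ Ideal.span {ϖ}).IsRadical) (hE1 : I ≤ (J ⊔ Ideal.span {ϖ}).radical) : ϖ ∈ J :=
  mem_of_mem_maximalIdeal_mul_of_le_sup hvb (le_sup_of_le_radical_of_isRadical hrad hE1)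

/-! ## Bad + regular strict transform ⇒ very bad -/

/-- If `z` is part of a regular system of parameters and `∑ cᵢ zᵢ ∈ 𝔪²`, then every `cᵢ ∈ 𝔪` (repackaging of the tree's
`mem_maximalIdeal_of_sum_mul_mem_sq_of_rsop`). [cite: Matsumura1987, Thm. 14.2] -/
theorem mem_maximalIdeal_of_sum_mul_mem_sq {R : Type u} [CommRing R] [IsLocalRing R] {n : ℕ} {z : Fin n → R}
    (hz : IsRsopPart z) (c : Fin n → R) (hc : ∑ i, c i * z i ∈ maximalIdeal R ^ 2) (i : Fin n) : c i ∈ maximalIdeal R := by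
  obtain ⟨hR, e, y, hdim, hspan⟩ := hz
  haveI := hR
  have hc' : ∑ i, c i * z i + ∑ j, (0 : Fin e → R) j * y j ∈ maximalIdeal R ^ 2 := by
    simpa using hc
  exact mem_maximalIdeal_of_sum_mul_mem_sq_of_rsop z y hdim hspan c 0 hc' i

/-- **BAD + `Ỹ` REGULAR AT `y` ⇒ VERY BAD (N6.2).** `R` regular local, `I ≤ 𝔪` with `R/I` regular, `ϖ ∈ I`, `ϖ ∈ 𝔪²` ⇒ `ϖ ∈ 𝔪·I`:
`I` is generated by a part `e` of a regular system of parameters, `ϖ = Σ aᵢ eᵢ ∈ 𝔪²` forces all `aᵢ ∈ 𝔪`. [cite: Matsumura1987, Thm. 14.2] -/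
theorem mem_maximalIdeal_mul_of_isRegularLocalRing_quotient {R : Type u} [CommRing R] [IsRegularLocalRing R] {I : Ideal R}
    (hI : I ≤ maximalIdeal R) (hreg : IsRegularLocalRing (R ⧸ I)) {ϖ : R} (hϖI : ϖ ∈ I) (hϖ2 : ϖ ∈ maximalIdeal R ^ 2) :
    ϖ ∈ maximalIdeal R * I := by
  haveI := hreg
  obtain ⟨n, z, hz, hspan⟩ := exists_isRsopPart_span_range_eq hI
  rw [← hspan] at hϖI ⊢
  obtain ⟨c, hc⟩ := Ideal.mem_span_range_iff_exists_fun.mp hϖI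
  rw [← hc] at hϖ2 ⊢
  refine Ideal.sum_mem _ fun i _ => ?_
  exact Ideal.mul_mem_mul (mem_maximalIdeal_of_sum_mul_mem_sq hz c hϖ2 i) (Ideal.subset_span ⟨i, rfl⟩)

/-- Contrapositive packaging: at a bad point that is NOT very bad, the strict transform is not regular. [cite: Matsumura1987, Thm. 14.2] -/
theorem not_isRegularLocalRing_quotient_of_bad_not_veryBad {R : Type u} [CommRing R] [IsRegularLocalRing R] {I : Ideal R}
    (hI : I ≤ maximalIdeal R) {ϖ : R} (hϖI : ϖ ∈ I) (hbad : ϖ ∈ maximalIdeal R ^ 2) (hnvb : ϖ ∉ maximalIdeal R * I) :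
    ¬ IsRegularLocalRing (R ⧸ I) := fun hreg =>
  hnvb (mem_maximalIdeal_mul_of_isRegularLocalRing_quotient hI hreg hϖI hbad)

/-! ## Scheme form -/

/-- **K-BADRED, SCHEME FORM (N6.2).** `r : X → Spec O` over a domain, `0 ≠ ϖ ∈ O` with germ `ϖ_y` at `y = ι c` (`ι : V(C) → X` the centre,
`c` a point of it), `Y` the ideal sheaf of the strict transform. If `y` is VERY BAD (`ϖ_y ∈ 𝔪_y · Y_y`) and `Y_y ≤ C_y + (ϖ_y)` (the special
fibre of the centre is reduced at `y` and lies in `Ỹ`, stalk form), then `V(C) → Spec O` is NOT flat: `ϖ_y ∈ C_y = ker ι_c^♯`, so the germ of `ϖ`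
on `V(C)` at `c` vanishes, contradicting `varpiGerm_ne_zero_of_flat`. OURS. -/
theorem not_flat_of_veryBad {O : Type} [CommRing O] [IsDomain O] {X : Scheme.{0}} (r : X ⟶ Spec (.of O)) (ϖ : O) (hϖ : ϖ ≠ 0)
    (Y C : X.IdealSheafData) (c : ↥C.subscheme)
    (hvb : (X.presheaf.Γgerm (C.subschemeι c)).hom (r.appTop.hom ((Scheme.ΓSpecIso (.of O)).inv.hom ϖ)) ∈
      maximalIdeal (X.presheaf.stalk (C.subschemeι c)) * stalkIdeal Y (C.subschemeι c))
    (hle : stalkIdeal Y (C.subschemeι c) ≤ stalkIdeal C (C.subschemeι c) ⊔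
      Ideal.span {(X.presheaf.Γgerm (C.subschemeι c)).hom (r.appTop.hom ((Scheme.ΓSpecIso (.of O)).inv.hom ϖ))}) :
    ¬ Flat (C.subschemeι ≫ r) := by
  intro hflat
  have hmem := mem_of_mem_maximalIdeal_mul_of_le_sup hvb hle
  have hne := varpiGerm_ne_zero_of_flat (C.subschemeι ≫ r) c ϖ hϖ
  rw [varpiGerm_comp r (C.subschemeι ≫ r) C.subschemeι rfl c ϖ] at hne
  apply hne
  have hker : (X.presheaf.Γgerm (C.subschemeι c)).hom (r.appTop.hom ((Scheme.ΓSpecIso (.of O)).inv.hom ϖ)) ∈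
      RingHom.ker (C.subschemeι.stalkMap c).hom := by
    rw [ker_stalkMap_subschemeι_eq_stalkIdeal]
    exact hmem
  exact hker

/-- **K-BADRED, scheme form with the geometric clauses separated**: very bad at `y = ι c`, the special fibre ideal `C_y + (ϖ_y)` radical
(reduced fibre at `y`) and `Y_y ≤ √(C_y + (ϖ_y))` (set-theoretic E1 at `y`) ⇒ `V(C)` is not `O`-flat. OURS. -/
theorem not_flat_of_veryBad_of_isRadical {O : Type} [CommRing O] [IsDomain O] {X : Scheme.{0}} (r : X ⟶ Spec (.of O)) (ϖ : O)
    (hϖ : ϖ ≠ 0) (Y C : X.IdealSheafData) (c : ↥C.subscheme)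
    (hvb : (X.presheaf.Γgerm (C.subschemeι c)).hom (r.appTop.hom ((Scheme.ΓSpecIso (.of O)).inv.hom ϖ)) ∈
      maximalIdeal (X.presheaf.stalk (C.subschemeι c)) * stalkIdeal Y (C.subschemeι c))
    (hrad : (stalkIdeal C (C.subschemeι c) ⊔
      Ideal.span {(X.presheaf.Γgerm (C.subschemeι c)).hom (r.appTop.hom ((Scheme.ΓSpecIso (.of O)).inv.hom ϖ))}).IsRadical)
    (hE1 : stalkIdeal Y (C.subschemeι c) ≤ (stalkIdeal C (C.subschemeι c) ⊔
      Ideal.span {(X.presheaf.Γgerm (C.subschemeι c)).hom (r.appTop.hom ((Scheme.ΓSpecIso (.of O)).inv.hom ϖ))}).radical) :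
    ¬ Flat (C.subschemeι ≫ r) :=
  not_flat_of_veryBad r ϖ hϖ Y C c hvb (le_sup_of_le_radical_of_isRadical hrad hE1)

/-- **Every point of a very bad locus is avoided by reduced-fibre centres** — support form: if `y ∈ supp C` is very bad and `Y_y ≤ C_y + (ϖ_y)`,
then `V(C) → Spec O` is not flat. OURS. -/
theorem not_flat_of_veryBad_of_mem_support {O : Type} [CommRing O] [IsDomain O] {X : Scheme.{0}} (r : X ⟶ Spec (.of O)) (ϖ : O)
    (hϖ : ϖ ≠ 0) (Y C : X.IdealSheafData) {y : X} (hy : y ∈ C.support)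
    (hvb : (X.presheaf.Γgerm y).hom (r.appTop.hom ((Scheme.ΓSpecIso (.of O)).inv.hom ϖ)) ∈
      maximalIdeal (X.presheaf.stalk y) * stalkIdeal Y y)
    (hle : stalkIdeal Y y ≤ stalkIdeal C y ⊔ Ideal.span {(X.presheaf.Γgerm y).hom (r.appTop.hom ((Scheme.ΓSpecIso (.of O)).inv.hom ϖ))}) :
    ¬ Flat (C.subschemeι ≫ r) := by
  have hy' : y ∈ Set.range C.subschemeι := by rw [Scheme.IdealSheafData.range_subschemeι]; exact hy
  obtain ⟨c, rfl⟩ := hy'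
  exact not_flat_of_veryBad r ϖ hϖ Y C c hvb hle

end BadRed

end Summit.ResolutionOfSingularities.ResolutionOfSingularities.Cruxes.EquisingularLiftNat.Sections
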